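import Summits.Ventures.AbcSig.Rows.XTemplateAB
import Summits.Ventures.AbcSig.Levels.N293
import Summits.Ventures.AbcSig.Levels.N586
import Summits.Ventures.AbcSig.Levels.N293M6X

/-!
# Venture AbcSig — ROW `C2aL293A6AB`: `293^m·xⁿ + 2^a·yⁿ = z²` (SECOND coefficient distribution of the cell; the distribution `xⁿ + 2^a·293^m·yⁿ = z²` is `Rows/C2aL293A6.lean`), class `a ge6` (GENERATED by plean/leanrow.py)

HONEST FRAMING. A row of a COMPUTATION cell (`pub-abcsig`); a CONDITIONAL theorem, no claim on ABC or any summit.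
Hypotheses: `BS04Package` (CITED), `DataComplete` at levels [293, 586] (COMPUTED, two-engine certified
level files), `EisPackage` (CITED: [BS04 (3.1), L4.2, Cor 3.1] + [Sturm 1987]) and `Refines` (COMPUTED) for the orbits whose residual exponent is discharged IN THE KERNEL by a module-M6 certificate (`Levels/N…M6X.lean`), and the listed per-orbit exclusions `hX_…` (CITED; the
row's R5 cell names each) that remain. Everything else is kernel-checked (`Rows/XTemplateC2a.lean`, `Levels/N….lean`). Exponent
range: prime `n ≥ 11`, `n ≠ 293`; `B = 2^a 293^m` with `a, m < n` (n-th-power free).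
Row of record:  (sha256 ; SIGNED 2026-08-22T09:50:52Z by referee (ref-g5)); its R0: THEOREM (uses CITED arithmetic facts) for all primes n >= 11 with n coprime to 18752 — class: candidate SHARPENING/new cell (see IK-applicability.md; lit FRESHN. Exponents left open by the row of record are excluded here via ; kernel-sieve residuals the row of record closes by a cell module (M6 Eisenstein / M4 Kraus certificates) appear as CITED hypotheses .
-/

namespace Summit.Ventures.AbcSig

/-- Row `C2aL293A6AB`: second coefficient distribution `293^m·xⁿ + 2^a·yⁿ = z²` (see module docstring). -/
theorem xrow_C2aL293A6AB (M : NewformModel) (hP : M.BS04Package) (hE : M.EisPackage)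
    (hD293 : M.DataComplete 293 level293Orbits) (hD586 : M.DataComplete 586 level586Orbits)
    (hR_orbit_293_2 : M.Refines 293 orbit_293_2 m6X_293_2)
    (n : ℕ) (hn : n.Prime) (hmin : 11 ≤ n) (hnℓ : n ≠ 293) (a m : ℕ) (ha : 6 ≤ a) (hm : 1 ≤ m) (han : a < n) (hmn : m < n)
    (hX_orbit_293_2 : n ∈ ([11] : List ℕ) → M.Excludes 293 orbit_293_2 (famAB (293 ^ m) (2 ^ a) n (fun _ _ => True)))
    (x y z : ℤ) (hxy1 : x * y ≠ 1) (hxy2 : x * y ≠ -1) : ¬ IsPrimitiveSolution (293 ^ m) (2 ^ a) 1 n x y z := by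
  have hℓ : Nat.Prime 293 := by norm_num
  have h7 : 7 ≤ n := by omega
  have hS293 :=
    (level293_sieve n hn h7 (fun o => M.Excludes 293 o (famAB (293 ^ m) (2 ^ a) n (fun _ _ => True)) ∨ M.ExcludesStd 293 o n) (fun hmem => by
      rcases (by simpa using hmem : n = 11 ∨ n = 73) with rfl | rfl
      · exact Or.inl (hX_orbit_293_2 (by simp))
      · exact Or.inr (m6c_293_2_n73_excludes M hE hR_orbit_293_2)))
  have hS586 :=
    (level586_sieve n hn h7 (fun o => M.Excludes 586 o (famAB (293 ^ m) (2 ^ a) n (fun _ _ => True)) ∨ M.ExcludesStd 586 o n) (fun hmem => by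
      obtain rfl : n = 7 := by simpa using hmem
      omega) (fun hmem => by
      obtain rfl : n = 7 := by simpa using hmem
      omega) (fun hmem => by
      obtain rfl : n = 7 := by simpa using hmem
      omega))
  by_cases ha6 : a = 6
  · subst ha6
    exact xrowC2aAB_a6 293 hℓ (by norm_num) M hP n hn h7 hnℓ hD293 hD586 m hm hmn
      hS293
      hS586 x y z hxy1 hxy2
  · exact xrowC2aAB_age7 293 hℓ (by norm_num) M hP n hn h7 hnℓ hD586 a m (by omega) hm han hmn
      hS586 x y z hxy1 hxy2

end Summit.Ventures.AbcSig
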